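import Mathlib

/-!
# Lexicographic products of ladders — finite-core certificate (support file)

Item `stmt-MatrixMultiplication-14308` (`FourierTwoFamiliesModP.PrimeTwoFamilies`, CKSU 2005 Conj. 4.7 with
prime cyclic hosts), line `Sketch`, registered stub `isLadder_lexProd`.

A LADDER in an additive commutative group `G` is an ordered family `(X c, Y c)_{c < r}` of finite subsets with

* (directness) `(x - x') + (y - y') = 0 → x = x' ∧ y = y'` for `x, x' ∈ X c`, `y, y' ∈ Y c`;
* (one-directional separation) for `p < q`, no lower cross difference `y' - x'` (`x' ∈ X p`,
  `y' ∈ Y q`) equals a diagonal difference `y - x` (`x ∈ X c`, `y ∈ Y c`).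

`isLadder_lexProd`: from a ladder indexed by `Fin r₁` in `G₁` and a ladder indexed by `Fin r₂` in `G₂`,
the `Fin (r₁ * r₂)`-indexed family `c ↦ (X₁ c.divNat ×ˢ X₂ c.modNat, Y₁ c.divNat ×ˢ Y₂ c.modNat)` in
`G₁ × G₂` is again a ladder (so class number, co-volume and host size all multiply).

Design ("certificate on the finite core").  The only combinatorial input is a fact about the finite
index set: the order of `Fin (r₁ * r₂)` IS the lexicographic order of the digit pairs
`(c.divNat, c.modNat)`.  We isolate it as an `iff` certificate — first over `ℕ` for an arbitrary modulus
(`lt_iff_div_lt_or_mod_lt`, valid also for modulus `0`), reduced to linear arithmetic over the atoms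
`R * (P / R)` and `P % R` and discharged by the decision procedure `omega`, then transported to
`Fin (r₁ * r₂)` (`lt_iff_divNat_lt_or_modNat_lt`).  The group-theoretic part is a componentwise split of
the two equations in `G₁ × G₂` (`Prod.mk_sub_mk`, `Prod.mk_add_mk`, `Prod.mk_eq_zero`, `Prod.mk.injEq`).

An independent proof of the same registered stub, via the one-directional consequence
`p < q → p.divNat < q.divNat ∨ p.modNat < q.modNat`, is
`Summit.MatrixMultiplication.MatrixMultiplication.Theorems.PrimeTwoFamilies.LadderLift.isLadder_lexProd`
(`FourierTwoFamiliesModPPrimeTwoFamiliesLadderLexProd.lean`); this file is self-contained and lives in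
its own namespace.
-/

-- single-conjunct summit: the mandated namespace repeats `MatrixMultiplication` (summit = sub-problem).
set_option linter.dupNamespace false

namespace Summit.MatrixMultiplication.MatrixMultiplication.Theorems.PrimeTwoFamilies.LadderLexProdFiniteCore

/-- **Finite core, `ℕ` form.**  For every modulus `R`, comparison of natural numbers is lexicographic in
the pair (quotient, remainder): `P < Q ↔ P / R < Q / R ∨ (P / R = Q / R ∧ P % R < Q % R)`.
(For `R = 0` both quotients vanish and the remainders are `P` and `Q` themselves.) -/
theorem lt_iff_div_lt_or_mod_lt (P Q R : ℕ) :
    P < Q ↔ P / R < Q / R ∨ (P / R = Q / R ∧ P % R < Q % R) := by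
  have hP := Nat.div_add_mod P R
  have hQ := Nat.div_add_mod Q R
  constructor
  · intro h
    rcases (Nat.div_le_div_right h.le : P / R ≤ Q / R).lt_or_eq with hlt | heq
    · exact Or.inl hlt
    · have hmul : R * (P / R) = R * (Q / R) := congrArg (R * ·) heq
      exact Or.inr ⟨heq, by omega⟩
  · rintro (hlt | ⟨heq, hlt⟩)
    · exact Nat.lt_of_div_lt_div hlt
    · have hmul : R * (P / R) = R * (Q / R) := congrArg (R * ·) heq
      omega

/-- **Finite core (certificate of the lexicographic order on `Fin (r₁ * r₂)`).**  For
`p q : Fin (r₁ * r₂)`, `p < q` holds iff the digit pairs compare lexicographically: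
`p.divNat < q.divNat`, or `p.divNat = q.divNat` and `p.modNat < q.modNat`. -/
theorem lt_iff_divNat_lt_or_modNat_lt {r₁ r₂ : ℕ} (p q : Fin (r₁ * r₂)) :
    p < q ↔ p.divNat < q.divNat ∨ (p.divNat = q.divNat ∧ p.modNat < q.modNat) := by
  simp only [Fin.lt_def, Fin.ext_iff, Fin.coe_divNat, Fin.coe_modNat]
  exact lt_iff_div_lt_or_mod_lt p q r₂

/-- **Lexicographic products of ladders are ladders** (registered stub `isLadder_lexProd`).  If
`(X₁ c, Y₁ c)_{c < r₁}` is a ladder in `G₁` (each class direct, `hW₁`; one-directionally separated,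
`hL₁`) and `(X₂ c, Y₂ c)_{c < r₂}` is a ladder in `G₂` (`hW₂`, `hL₂`), then the family indexed by
`c : Fin (r₁ * r₂)` with classes `X₁ c.divNat ×ˢ X₂ c.modNat` and `Y₁ c.divNat ×ˢ Y₂ c.modNat` in
`G₁ × G₂` is a ladder: every class is direct (first conjunct, componentwise) and the family is
one-directionally separated (second conjunct: by the finite-core certificate, `p < q` means
`p.divNat < q.divNat` — separate in `G₁` — or `p.divNat = q.divNat ∧ p.modNat < q.modNat` — separate
in `G₂`). -/
theorem isLadder_lexProd {G₁ G₂ : Type*} [AddCommGroup G₁] [AddCommGroup G₂] {r₁ r₂ : ℕ}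
    (X₁ Y₁ : Fin r₁ → Finset G₁) (X₂ Y₂ : Fin r₂ → Finset G₂)
    (hW₁ : ∀ c : Fin r₁, ∀ x ∈ X₁ c, ∀ x' ∈ X₁ c, ∀ y ∈ Y₁ c, ∀ y' ∈ Y₁ c,
      (x - x') + (y - y') = 0 → x = x' ∧ y = y')
    (hL₁ : ∀ c p q : Fin r₁, p < q → ∀ x ∈ X₁ c, ∀ y ∈ Y₁ c, ∀ x' ∈ X₁ p, ∀ y' ∈ Y₁ q,
      y - x ≠ y' - x')
    (hW₂ : ∀ c : Fin r₂, ∀ x ∈ X₂ c, ∀ x' ∈ X₂ c, ∀ y ∈ Y₂ c, ∀ y' ∈ Y₂ c,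
      (x - x') + (y - y') = 0 → x = x' ∧ y = y')
    (hL₂ : ∀ c p q : Fin r₂, p < q → ∀ x ∈ X₂ c, ∀ y ∈ Y₂ c, ∀ x' ∈ X₂ p, ∀ y' ∈ Y₂ q,
      y - x ≠ y' - x') :
    (∀ c : Fin (r₁ * r₂), ∀ x ∈ X₁ c.divNat ×ˢ X₂ c.modNat, ∀ x' ∈ X₁ c.divNat ×ˢ X₂ c.modNat,
        ∀ y ∈ Y₁ c.divNat ×ˢ Y₂ c.modNat, ∀ y' ∈ Y₁ c.divNat ×ˢ Y₂ c.modNat,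
        (x - x') + (y - y') = 0 → x = x' ∧ y = y') ∧
    (∀ c p q : Fin (r₁ * r₂), p < q →
        ∀ x ∈ X₁ c.divNat ×ˢ X₂ c.modNat, ∀ y ∈ Y₁ c.divNat ×ˢ Y₂ c.modNat,
        ∀ x' ∈ X₁ p.divNat ×ˢ X₂ p.modNat, ∀ y' ∈ Y₁ q.divNat ×ˢ Y₂ q.modNat,
        y - x ≠ y' - x') := by
  constructor
  · -- directness: the equation in `G₁ × G₂` is the conjunction of its two components.
    rintro c ⟨x₁, x₂⟩ hx ⟨x₁', x₂'⟩ hx' ⟨y₁, y₂⟩ hy ⟨y₁', y₂'⟩ hy' h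
    simp only [Finset.mem_product] at hx hx' hy hy'
    simp only [Prod.mk_sub_mk, Prod.mk_add_mk, Prod.mk_eq_zero] at h
    obtain ⟨hx₁, hy₁⟩ := hW₁ c.divNat x₁ hx.1 x₁' hx'.1 y₁ hy.1 y₁' hy'.1 h.1
    obtain ⟨hx₂, hy₂⟩ := hW₂ c.modNat x₂ hx.2 x₂' hx'.2 y₂ hy.2 y₂' hy'.2 h.2
    exact ⟨Prod.ext hx₁ hx₂, Prod.ext hy₁ hy₂⟩
  · -- separation: read `p < q` through the finite-core certificate and separate in that coordinate.
    rintro c p q hpq ⟨x₁, x₂⟩ hx ⟨y₁, y₂⟩ hy ⟨x₁', x₂'⟩ hx' ⟨y₁', y₂'⟩ hy' h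
    simp only [Finset.mem_product] at hx hy hx' hy'
    simp only [Prod.mk_sub_mk, Prod.mk.injEq] at h
    rcases (lt_iff_divNat_lt_or_modNat_lt p q).1 hpq with hlt | ⟨-, hlt⟩
    · exact hL₁ c.divNat p.divNat q.divNat hlt x₁ hx.1 y₁ hy.1 x₁' hx'.1 y₁' hy'.1 h.1
    · exact hL₂ c.modNat p.modNat q.modNat hlt x₂ hx.2 y₂ hy.2 x₂' hx'.2 y₂' hy'.2 h.2

end Summit.MatrixMultiplication.MatrixMultiplication.Theorems.PrimeTwoFamilies.LadderLexProdFiniteCore
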